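import Mathlib
import HarnessLib
import Literature.Combinatorics.HironakaPolyhedraGame.Spivakovsky1983Invariant

/-!
# Spivakovsky's invariant, part 2/4: the derived position, denominators, and the move calculus

Source: [Spivakovsky1983] §I (definition of `Δ₁`, Notation (g)), §III proof of Lemma 2 (a) (the
Claim: `Δ̃' = [σ̃_{Γ,i}(Δ̃)]` with `x̃'_i = Σ_{j∈Γ} x̃_j − d_Γ(Δ̃)`), and the closing argument p. 432
(bounded denominators).  Everything ON GENERATORS, continuing `Spivakovsky1983Invariant.lean`:

* sums over `I₁ = Sᶜ` re-indexed by `Fin #I₁`, over the lifted move `Γ = S ∪ Γ₁`, and of `P_S`;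
  membership in `derived S A` and in `genSet A`;
* `(1/N)ℤ`-lattice bookkeeping: `d(Δ̃) ∈ (1/N)ℕ`, so a strict drop of `d(Δ̃)` is a drop of the natural
  number `N·d(Δ̃)` (this is the only use of the rationality of the generators, as in the paper);
* the effect of a move `σ_{Γ,i}` on `ω`, `ã` and `|ã|` (Claim (1)–(2) of the proof of Lemma 2 (a)).

No new definitions.  Parts 3–4: `Spivakovsky1983Lemmas.lean`, `Spivakovsky1983Proof.lean`.
-/

namespace Literature.Combinatorics.HironakaPolyhedraGame

namespace Spivakovsky1983

open Finset

variable {n : ℕ}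

/-! ## Sums over `Sᶜ`, `P_S`, the lifted move; membership in `Δ₁` -/

/-- Re-indexing a sum over `I₁ = Sᶜ` by `Fin (#I₁)`. [cite: Spivakovsky1983, §I Notation (g) p. 421] -/
theorem sum_enumCompl (S : Finset (Fin n)) (f : Fin n → ℚ) :
    ∑ t, f (enumCompl S t) = ∑ j ∈ Sᶜ, f j := by
  rw [← Finset.sum_coe_sort Sᶜ f]
  exact Fintype.sum_equiv (Sᶜ.orderIsoOfFin rfl).toEquiv _ _ (fun t => rfl)

/-- The enumeration of `Sᶜ` lands in `Sᶜ`. [cite: Spivakovsky1983, §I Notation (g) p. 421] -/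
theorem enumCompl_mem_compl (S : Finset (Fin n)) (t : Fin (Sᶜ.card)) : enumCompl S t ∈ Sᶜ :=
  ((Sᶜ.orderIsoOfFin rfl) t).2

/-- The enumeration of `Sᶜ` avoids `S`. [cite: Spivakovsky1983, §I Notation (g) p. 421] -/
theorem enumCompl_not_mem (S : Finset (Fin n)) (t : Fin (Sᶜ.card)) : enumCompl S t ∉ S :=
  Finset.mem_compl.1 (enumCompl_mem_compl S t)

/-- `S` and (the image of) `Γ₁ ⊆ I₁` are disjoint. [cite: Spivakovsky1983, §II p. 422] -/
theorem disjoint_map_enumCompl (S : Finset (Fin n)) (Γ₁ : Finset (Fin (Sᶜ.card))) :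
    Disjoint S (Γ₁.map (enumCompl S)) := by
  rw [Finset.disjoint_right]
  intro j hj
  obtain ⟨t, _, rfl⟩ := Finset.mem_map.1 hj
  exact enumCompl_not_mem S t

/-- `Σ_{Γ} = Σ_S + Σ_{Γ₁}` for the lifted move `Γ = S ∪ Γ₁`. [cite: Spivakovsky1983, §II p. 422; §III proof of Lemma 1] -/
theorem sum_liftMove (S : Finset (Fin n)) (Γ₁ : Finset (Fin (Sᶜ.card))) (f : Fin n → ℚ) :
    ∑ j ∈ liftMove S Γ₁, f j = ∑ j ∈ S, f j + ∑ t ∈ Γ₁, f (enumCompl S t) := by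
  rw [liftMove, Finset.sum_union (disjoint_map_enumCompl S Γ₁), Finset.sum_map]

/-- `Σ_{t∈Γ₁} P_S(w)_t = (Σ_{t∈Γ₁} w_t)/(1 − |β|)`. [cite: Spivakovsky1983, §I Notation (g) p. 421] -/
theorem sum_proj (S : Finset (Fin n)) (w : Fin n → ℚ) (Γ₁ : Finset (Fin (Sᶜ.card))) :
    ∑ t ∈ Γ₁, proj S w t = (∑ t ∈ Γ₁, w (enumCompl S t)) / (1 - ∑ j ∈ S, w j) := by
  simp only [proj]
  rw [Finset.sum_div]

/-- `|P_S(w)| = |α|/(1 − |β|)` for `w = (α, β)`. [cite: Spivakovsky1983, §I Notation (g) p. 421] -/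
theorem sum_proj_univ (S : Finset (Fin n)) (w : Fin n → ℚ) :
    ∑ t, proj S w t = (∑ j ∈ Sᶜ, w j) / (1 - ∑ j ∈ S, w j) := by
  rw [sum_proj, sum_enumCompl]

/-- Membership in the derived position `Δ₁` on generators. [cite: Spivakovsky1983, §I definition of Δ₁, p. 421] -/
theorem mem_derived {S : Finset (Fin n)} {A : Finset (Fin n → ℚ)} {y : Fin (Sᶜ.card) → ℚ} :
    y ∈ derived S A ↔ ∃ w ∈ genSet A, ∑ j ∈ S, w j < 1 ∧ proj S w = y := by
  classical
  simp only [derived, Finset.mem_image, Finset.mem_filter]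
  constructor
  · rintro ⟨w, ⟨hw, hS⟩, rfl⟩; exact ⟨w, hw, hS, rfl⟩
  · rintro ⟨w, hw, hS, rfl⟩; exact ⟨w, ⟨hw, hS⟩, rfl⟩

/-- A generator `w` with `Σ_S w < 1` contributes `P_S(w)` to `Δ₁`. [cite: Spivakovsky1983, §I definition of Δ₁, p. 421] -/
theorem mem_derived_of {S : Finset (Fin n)} {A : Finset (Fin n → ℚ)} {w : Fin n → ℚ}
    (hw : w ∈ genSet A) (hS : ∑ j ∈ S, w j < 1) : proj S w ∈ derived S A :=
  mem_derived.2 ⟨w, hw, hS, rfl⟩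

/-- `A ⊆ Ã/d̃ ∪ A`. [cite: Spivakovsky1983, §I definition of Δ₁, p. 421] -/
theorem mem_genSet_left {A : Finset (Fin n → ℚ)} {a : Fin n → ℚ} (ha : a ∈ A) : a ∈ genSet A :=
  Finset.mem_union_left _ ha

/-- `Ã/d̃ ⊆ Ã/d̃ ∪ A`. [cite: Spivakovsky1983, §I definition of Δ₁, p. 421] -/
theorem mem_genSet_right {A : Finset (Fin n → ℚ)} {a : Fin n → ℚ} (ha : a ∈ A) :
    (fun j => tilde A a j / dTilde A) ∈ genSet A :=
  Finset.mem_union_right _ (Finset.mem_image_of_mem _ ha)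

/-- Membership in the generating set `Ã/d̃ ∪ A` of `[Δ̃/d(Δ̃) ∪ Δ]`. [cite: Spivakovsky1983, §I definition of Δ₁, p. 421] -/
theorem mem_genSet {A : Finset (Fin n → ℚ)} {w : Fin n → ℚ} :
    w ∈ genSet A ↔ w ∈ A ∨ ∃ a ∈ A, (fun j => tilde A a j / dTilde A) = w := by
  simp only [genSet, Finset.mem_union, Finset.mem_image]

/-- The generators in `Ã/d̃ ∪ A` have non-negative coordinates. [cite: Spivakovsky1983, §I p. 421] -/
theorem genSet_nonneg {A : Finset (Fin n → ℚ)} (hA : IsPosition A) {w : Fin n → ℚ}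
    (hw : w ∈ genSet A) (j : Fin n) : 0 ≤ w j := by
  rcases mem_genSet.1 hw with hwA | ⟨a, ha, rfl⟩
  · exact hA.2 w hwA j
  · exact div_nonneg (tilde_nonneg ha j) (dTilde_nonneg A)

/-! ## Bounded denominators -/

/-- `ã_j ∈ (1/N)ℤ` on a `(1/N)ℤ`-lattice set. [cite: Spivakovsky1983, §III p. 432] -/
theorem exists_tilde_eq_div {N : ℕ} {A : Finset (Fin n → ℚ)} (hL : IsLattice N A)
    {a : Fin n → ℚ} (ha : a ∈ A) (j : Fin n) : ∃ z : ℤ, tilde A a j = z / N := by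
  obtain ⟨b, hb, hbj⟩ := exists_apply_eq_omega ⟨a, ha⟩ j
  obtain ⟨z, hz⟩ := hL a ha j
  obtain ⟨z', hz'⟩ := hL b hb j
  refine ⟨z - z', ?_⟩
  simp only [tilde, ← hbj, hz, hz']
  push_cast
  ring

/-- `Σ_{j∈Γ} ã_j ∈ (1/N)ℕ` on a `(1/N)ℤ`-lattice set. [cite: Spivakovsky1983, §III p. 432] -/
theorem exists_sum_tilde_eq_div {N : ℕ} (hN : 0 < N) {A : Finset (Fin n → ℚ)} (hL : IsLattice N A)
    {a : Fin n → ℚ} (ha : a ∈ A) (Γ : Finset (Fin n)) :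
    ∃ m : ℕ, ∑ j ∈ Γ, tilde A a j = m / N := by
  choose z hz using fun j => exists_tilde_eq_div hL ha j
  have hsum : ∑ j ∈ Γ, tilde A a j = (∑ j ∈ Γ, z j : ℤ) / N := by
    rw [Finset.sum_congr rfl (fun j _ => hz j), ← Finset.sum_div]
    push_cast
    rfl
  have hnn : 0 ≤ ∑ j ∈ Γ, z j := by
    have h0 : (0 : ℚ) ≤ (∑ j ∈ Γ, z j : ℤ) / N := by
      rw [← hsum]
      exact Finset.sum_nonneg (fun j _ => tilde_nonneg ha j)
    have hN' : (0 : ℚ) < N := by exact_mod_cast hN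
    have := (div_nonneg_iff.1 h0)
    rcases this with ⟨h1, _⟩ | ⟨_, h2⟩
    · exact_mod_cast h1
    · exact absurd h2 (not_le.2 hN')
  refine ⟨(∑ j ∈ Γ, z j).toNat, ?_⟩
  rw [hsum]
  congr 1
  have := Int.toNat_of_nonneg hnn
  exact_mod_cast this.symm

/-- `d(Δ̃) ∈ (1/N)ℕ` on a `(1/N)ℤ`-lattice position («N is an upper bound for the denominator of d(Δ̃)»). [cite: Spivakovsky1983, §III p. 432] -/
theorem exists_dTilde_eq_div {N : ℕ} (hN : 0 < N) {A : Finset (Fin n → ℚ)} (hA : IsPosition A)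
    (hL : IsLattice N A) : ∃ m : ℕ, dTilde A = m / N := by
  obtain ⟨a, ha, hsum⟩ := exists_dTildeOn_eq hA.1 univ
  obtain ⟨m, hm⟩ := exists_sum_tilde_eq_div hN hL ha univ
  exact ⟨m, by unfold dTilde; rw [← hsum, hm]⟩

/-- On `(1/N)ℤ`-lattice positions a strict drop of `d(Δ̃)` is a strict drop of the natural number `N·d(Δ̃)`. [cite: Spivakovsky1983, §III p. 432] -/
theorem floor_dTilde_lt {N : ℕ} (hN : 0 < N) {A A' : Finset (Fin n → ℚ)} (hA : IsPosition A)
    (hL : IsLattice N A) (hA' : IsPosition A') (hL' : IsLattice N A')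
    (h : dTilde A' < dTilde A) : ⌊(N : ℚ) * dTilde A'⌋₊ < ⌊(N : ℚ) * dTilde A⌋₊ := by
  obtain ⟨m, hm⟩ := exists_dTilde_eq_div hN hA hL
  obtain ⟨m', hm'⟩ := exists_dTilde_eq_div hN hA' hL'
  have hN' : (0 : ℚ) < N := by exact_mod_cast hN
  rw [hm, hm', mul_div_cancel₀ _ hN'.ne', mul_div_cancel₀ _ hN'.ne', Nat.floor_natCast,
    Nat.floor_natCast]
  rw [hm, hm'] at h
  have := (div_lt_div_iff_of_pos_right hN').1 h
  exact_mod_cast this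

/-! ## The effect of a move on `ω`, `ã`, `|ã|` (Claim in the proof of Lemma 2 (a)) -/

/-- `c ≤ ω(A)_j` iff `c ≤ a_j` for all generators. [cite: Spivakovsky1983, §I Notation (a) p. 420] -/
theorem le_omega_iff {A : Finset (Fin n → ℚ)} (hA : A.Nonempty) {j : Fin n} {c : ℚ} :
    c ≤ omega A j ↔ ∀ a ∈ A, c ≤ a j := by
  simp only [omega, dif_pos hA, Finset.le_inf'_iff]

/-- `σ_{Γ,i}` fixes the coordinates `j ≠ i`. [cite: Spivakovsky1983, §I p. 420] -/
theorem gameMove_apply_of_ne {Γ : Finset (Fin n)} {i j : Fin n} (hj : j ≠ i) (x : Fin n → ℚ) :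
    gameMove Γ i x j = x j := by
  simp [gameMove, hj]

/-- `σ_{Γ,i}(x)_i = Σ_{j∈Γ} x_j − 1`. [cite: Spivakovsky1983, §I p. 420] -/
theorem gameMove_apply_self (Γ : Finset (Fin n)) (i : Fin n) (x : Fin n → ℚ) :
    gameMove Γ i x i = (∑ k ∈ Γ, x k) - 1 := by
  simp [gameMove]

/-- `ω'_j = ω_j` for `j ≠ i` after the move `σ_{Γ,i}`. [cite: Spivakovsky1983, §III proof of Lemma 2 (a), p. 424] -/
theorem omega_image_of_ne {A : Finset (Fin n → ℚ)} (hA : A.Nonempty) (Γ : Finset (Fin n))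
    {i j : Fin n} (hj : j ≠ i) : omega (A.image (gameMove Γ i)) j = omega A j := by
  have hA' : (A.image (gameMove Γ i)).Nonempty := hA.image _
  apply le_antisymm
  · obtain ⟨b, hb, hbj⟩ := exists_apply_eq_omega hA j
    have := omega_le (Finset.mem_image_of_mem (gameMove Γ i) hb) j
    rwa [gameMove_apply_of_ne hj, hbj] at this
  · rw [le_omega_iff hA']
    intro a' ha'
    obtain ⟨a, ha, rfl⟩ := Finset.mem_image.1 ha'
    rw [gameMove_apply_of_ne hj]
    exact omega_le ha j

/-- `Σ_Γ a = Σ_Γ ω + Σ_Γ ã`. [cite: Spivakovsky1983, §I Notation (d) p. 421] -/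
theorem sum_eq_sum_omega_add_sum_tilde (A : Finset (Fin n → ℚ)) (a : Fin n → ℚ)
    (Γ : Finset (Fin n)) :
    ∑ k ∈ Γ, a k = ∑ k ∈ Γ, omega A k + ∑ k ∈ Γ, tilde A a k := by
  rw [← Finset.sum_add_distrib]
  refine Finset.sum_congr rfl (fun k _ => ?_)
  simp [tilde]

/-- `ω'_i = Σ_Γ ω + d_Γ(Δ̃) − 1` after the move `σ_{Γ,i}` (the constant `C` of the Claim). [cite: Spivakovsky1983, §III proof of Lemma 2 (a), Claim (1), p. 424] -/
theorem omega_image_self {A : Finset (Fin n → ℚ)} (hA : A.Nonempty) (Γ : Finset (Fin n))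
    (i : Fin n) :
    omega (A.image (gameMove Γ i)) i = ∑ k ∈ Γ, omega A k + dTildeOn A Γ - 1 := by
  have hA' : (A.image (gameMove Γ i)).Nonempty := hA.image _
  apply le_antisymm
  · obtain ⟨b, hb, hbΓ⟩ := exists_dTildeOn_eq hA Γ
    have := omega_le (Finset.mem_image_of_mem (gameMove Γ i) hb) i
    rw [gameMove_apply_self, sum_eq_sum_omega_add_sum_tilde A b Γ, hbΓ] at this
    exact this
  · rw [le_omega_iff hA']
    intro a' ha'
    obtain ⟨a, ha, rfl⟩ := Finset.mem_image.1 ha'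
    rw [gameMove_apply_self, sum_eq_sum_omega_add_sum_tilde A a Γ]
    have := dTildeOn_le ha Γ
    linarith

/-- `ã'_j = ã_j` for `j ≠ i`: the transformation `σ̃_{Γ,i}` off the `i`-th coordinate. [cite: Spivakovsky1983, §III Lemma 2 (a), Claim (1), p. 424] -/
theorem tilde_image_of_ne {A : Finset (Fin n → ℚ)} (hA : A.Nonempty) (Γ : Finset (Fin n))
    {i j : Fin n} (hj : j ≠ i) (a : Fin n → ℚ) :
    tilde (A.image (gameMove Γ i)) (gameMove Γ i a) j = tilde A a j := by
  simp only [tilde, omega_image_of_ne hA Γ hj, gameMove_apply_of_ne hj]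

/-- `ã'_i = Σ_{j∈Γ} ã_j − d_Γ(Δ̃)`: the transformation `σ̃_{Γ,i}` on the `i`-th coordinate. [cite: Spivakovsky1983, §III Lemma 2 (a), Claim (1), p. 424] -/
theorem tilde_image_self {A : Finset (Fin n → ℚ)} (hA : A.Nonempty) (Γ : Finset (Fin n))
    (i : Fin n) (a : Fin n → ℚ) :
    tilde (A.image (gameMove Γ i)) (gameMove Γ i a) i = ∑ k ∈ Γ, tilde A a k - dTildeOn A Γ := by
  simp only [tilde]
  rw [omega_image_self hA Γ i, gameMove_apply_self, sum_eq_sum_omega_add_sum_tilde A a Γ]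
  simp only [tilde]
  ring

/-- `|ã'| = |ã| − ã_i + (Σ_Γ ã − d_Γ(Δ̃))` for `a' = σ_{Γ,i}(a)`. [cite: Spivakovsky1983, §III Lemma 2 (a), (1)–(2), p. 424] -/
theorem sum_tilde_image {A : Finset (Fin n → ℚ)} (hA : A.Nonempty) (Γ : Finset (Fin n))
    (i : Fin n) (a : Fin n → ℚ) :
    ∑ j, tilde (A.image (gameMove Γ i)) (gameMove Γ i a) j =
      ∑ j, tilde A a j - tilde A a i + (∑ k ∈ Γ, tilde A a k - dTildeOn A Γ) := by
  have h1 : ∑ j, tilde (A.image (gameMove Γ i)) (gameMove Γ i a) j =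
      ∑ j, (if j = i then ∑ k ∈ Γ, tilde A a k - dTildeOn A Γ else tilde A a j) := by
    refine Finset.sum_congr rfl (fun j _ => ?_)
    split_ifs with hj
    · rw [hj, tilde_image_self hA]
    · rw [tilde_image_of_ne hA Γ hj]
  have h2 : ∑ j, tilde A a j = ∑ j, (if j = i then tilde A a i else tilde A a j) := by
    refine Finset.sum_congr rfl (fun j _ => ?_)
    split_ifs with hj
    · rw [hj]
    · rfl
  rw [h1, h2, Finset.sum_ite, Finset.sum_ite]
  have hfilter : (Finset.univ.filter (fun j : Fin n => j = i)) = {i} := by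
    ext j; simp
  rw [hfilter]
  simp only [Finset.sum_singleton]
  ring

/-- A minimiser `a` of `|ã|` with `d_Γ(Δ̃) = d(Δ̃)` has `Σ_Γ ã = d(Δ̃)`. [cite: Spivakovsky1983, §III Lemma 2 (a), p. 424] -/
theorem sum_tilde_on_eq_of_min {A : Finset (Fin n → ℚ)} {a : Fin n → ℚ} (ha : a ∈ A)
    (hmin : ∑ j, tilde A a j = dTilde A) {Γ : Finset (Fin n)} (hΓ : dTildeOn A Γ = dTilde A) :
    ∑ k ∈ Γ, tilde A a k = dTilde A := by
  apply le_antisymm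
  · rw [← hmin]
    exact Finset.sum_le_sum_of_subset_of_nonneg (Finset.subset_univ Γ)
      (fun j _ _ => tilde_nonneg ha j)
  · rw [← hΓ]; exact dTildeOn_le ha Γ

end Spivakovsky1983

end Literature.Combinatorics.HironakaPolyhedraGame
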